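import Summits.ValiantsHypothesis.ValiantsHypothesis.Theorems.DivisionGapPerDivisionHardStubSparseRigid

/-!
# Crux `DivisionGap.PerDivisionHard` (stmt-ValiantsHypothesis-5065), line `pair-descent-jss-endpoint` —
stub `stub_midRigid`: local rigidity of the placed block arsenal `G(b,1) ⊕ M₀`

With `k = 1` the core edge `(i, j)` of `K_{b,b}` becomes the three-cell path
row `i` — col `(i,j,0)` — row `(i,j,0)` — col `j` (`blockAdj` of `Theorems/DivisionGapDefs.lean`).
`stub_midRigid`: two exponent vectors `m₁, m₂` with equal row margins and equal column margins,
agreeing off the placed face `placedBlock eR eC` and on its `b²` doubly-internal cells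
`(row (i,j,0), col (i,j,0))`, are equal.

Proof.  The difference `D = m₁ - m₂` is an integer matrix supported on the placed face with
vanishing row and column sums (`sum_diff_eq_zero`), i.e. a circulation of the label graph
(`labelFlow_of_placed`).  A nonzero entry of a circulation lies on a path `(i, j)` with nonzero
path value (`exists_pathVal_ne_zero`), and the internal row `(i,j,0)` carries minus the path value
at its own column `(i,j,0)` (`flow_path`) — but `D` vanishes there by hypothesis.  So `D = 0`.
-/

noncomputable section

-- `Summit.ValiantsHypothesis.ValiantsHypothesis.…` is the tree's mandated single-conjunct layout
-- (Sub = Summit), so the duplicated namespace component is intended.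
set_option linter.dupNamespace false

namespace Summit.ValiantsHypothesis.ValiantsHypothesis.Theorems.DivisionGapPerDivisionHard

open MvPolynomial Literature.Computability.AlgebraicComplexity
open scoped NNReal

/-- **`stub_midRigid` (LOCAL RIGIDITY of `G(b,1) ⊕ M₀`, line `pair-descent-jss-endpoint`).**  Two
exponent vectors with equal row margins and equal column margins that agree off the placed face
`placedBlock eR eC` (`k = 1`) and on its `b²` doubly-internal cells `(row (i,j,0), col (i,j,0))`
are equal: their difference is a circulation of the label graph (`labelFlow_of_placed`,
`sum_diff_eq_zero`), a nonzero circulation has a nonzero path value (`exists_pathVal_ne_zero`),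
and the doubly-internal cell of that path carries minus the path value (`flow_path`). [folklore] -/
theorem stub_midRigid :
    ∀ (b m n : ℕ) (eR eC : BlockV b 1 m ≃ Fin n) (m₁ m₂ : (Fin n × Fin n) →₀ ℕ),
      (∀ e ∉ placedBlock eR eC, m₁ e = m₂ e) →
      rowDegrees m₁ = rowDegrees m₂ → Finsupp.mapDomain Prod.snd m₁ = Finsupp.mapDomain Prod.snd m₂ →
      (∀ i j : Fin b, m₁ (eR (Sum.inr (Sum.inl (i, j, 0))), eC (Sum.inr (Sum.inl (i, j, 0)))) =
        m₂ (eR (Sum.inr (Sum.inl (i, j, 0))), eC (Sum.inr (Sum.inl (i, j, 0))))) →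
      m₁ = m₂ := by
  intro b m n eR eC m₁ m₂ hoff hr hc hmid
  -- the difference `D = m₁ - m₂`: supported on the placed face, vanishing margins
  obtain ⟨hrow, hcol⟩ := sum_diff_eq_zero hr hc
  have hDG : ∀ e, (fun e => (m₁ e : ℤ) - m₂ e) e ≠ 0 → e ∈ placedBlock eR eC := fun e he => by
    by_contra heG
    exact he (by simp only [hoff e heG, sub_self])
  have hF := labelFlow_of_placed eR eC hDG hrow hcol
  -- every entry of `D` vanishes
  refine Finsupp.ext fun e => ?_
  by_contra hne
  have h0 : (fun r ℓ => (fun e => (m₁ e : ℤ) - m₂ e) (eR r, eC ℓ)) (eR.symm e.1) (eC.symm e.2) ≠ 0 := by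
    simp only [Equiv.apply_symm_apply, Prod.mk.eta]
    exact fun h => hne (by exact_mod_cast sub_eq_zero.mp h)
  obtain ⟨i, j, hij⟩ := exists_pathVal_ne_zero hF Nat.one_pos h0
  have hpath := (flow_path hF Nat.one_pos i j 0 Nat.one_pos).1
  have hzero : (m₁ (eR (iv i j ⟨0, Nat.one_pos⟩), eC (iv i j ⟨0, Nat.one_pos⟩)) : ℤ) -
      m₂ (eR (iv i j ⟨0, Nat.one_pos⟩), eC (iv i j ⟨0, Nat.one_pos⟩)) = 0 :=
    sub_eq_zero.mpr (by exact_mod_cast hmid i j)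
  rw [hzero] at hpath
  exact hij (neg_eq_zero.mp hpath.symm)

end Summit.ValiantsHypothesis.ValiantsHypothesis.Theorems.DivisionGapPerDivisionHard

end
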